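import Mathlib
import HarnessLib

/-!
# Low-order closed Newton–Cotes rules: Simpson's 3/8 rule, Boole's rule, the odd-point bonus
(Davis–Rabinowitz 1984, Sect. 2.5)

Davis–Rabinowitz, *Methods of Numerical Integration* (2nd ed., 1984), Sect. 2.5 "Integration Formulas of
Interpolatory Type", pp. 77–79: after the trapezoidal and Simpson rules, "the next few rules" of the closed
Newton–Cotes family — Simpson's `3/8` rule (2.5.19) with `E = -(3/80) h⁵ f⁽⁴⁾(ξ)` (2.5.20) and Boole's rule
(2.5.21) with `E = -(8/945) h⁷ f⁽⁶⁾(ξ)` (2.5.22) — and the remark (2.5.27) that a rule with an odd number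
`2k - 1` of points has error `c_k h^{2k+1} f^{(2k)}(ξ)`, one order more than interpolation predicts.

Recorded (self-contained, by coefficientwise expansion of polynomials): the two rules as `simpsonThreeEighths`,
`booleRule`; their polynomial exactness (degree `≤ 3`, resp. `≤ 5`); the error constants of (2.5.20)/(2.5.22)
*pinned on the first non-exact degree* (`∫ p - R p = -(3/80) h⁵ · 24 c₄` for quartics, `-(8/945) h⁷ · 720 c₆` for
sextics — the `ξ`-forms for general `f ∈ C⁴`, `C⁶` follow from Peano's theorem and are not restated); and the
mechanism of (2.5.27) as a general theorem `exact_natDegree_succ_of_symmetric`: a reflection-symmetric rule exact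
on `𝒫_n` with `n` even is exact on `𝒫_{n+1}`.  The general closed Newton–Cotes rule as an interpolatory rule
(weights (2.5.12), exactness of degree `n`) is the tree's `InterpolatoryQuadrature`; this file does not import it.

Provenance: engines group, shared numerical engines serving client cells; rigour lives in the verifiers; every
published number belongs to a client cell's ledger, not to the engines group.  Textbook facts only (no client
numbers).
-/

namespace Literature.Analysis.Quadrature

open Set MeasureTheory intervalIntegral Finset Polynomial
open scoped Real Interval

noncomputable section

/-! ### Polynomials: evaluation and integration coefficientwise -/

/-- [folklore] `∫_a^b p = Σ_{i<n} c_i (b^{i+1} - a^{i+1})/(i+1)` for `deg p < n`. -/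
private theorem integral_eval_eq_sum (p : ℝ[X]) {n : ℕ} (hn : p.natDegree < n) (a b : ℝ) :
    ∫ x in a..b, p.eval x = ∑ i ∈ range n, p.coeff i * ((b ^ (i + 1) - a ^ (i + 1)) / (i + 1)) := by
  simp_rw [eval_eq_sum_range' hn]
  rw [intervalIntegral.integral_finsetSum fun i _ => ?_]
  · refine Finset.sum_congr rfl fun i _ => ?_
    rw [intervalIntegral.integral_const_mul, integral_pow]
  · exact (continuous_const.mul (continuous_pow i)).intervalIntegrable _ _

/-! ### Simpson's three-eighths rule (2.5.19)–(2.5.20) -/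

/-- Simpson's `3/8` rule (the closed 4-point Newton–Cotes rule, `h = (b - a)/3`):
`3h/8 (f_0 + 3 f_1 + 3 f_2 + f_3)`. [cite: DavisRabinowitz1984, Sect. 2.5 (2.5.19)] -/
def simpsonThreeEighths (f : ℝ → ℝ) (a b : ℝ) : ℝ :=
  (b - a) / 8 * (f a + 3 * f (a + (b - a) / 3) + 3 * f (a + 2 * (b - a) / 3) + f b)

/-- (2.5.19): the `3/8` rule integrates cubics exactly. [cite: DavisRabinowitz1984, Sect. 2.5 (2.5.19)] -/
theorem integral_eq_simpsonThreeEighths_of_natDegree_le (p : ℝ[X]) (hp : p.natDegree ≤ 3) (a b : ℝ) :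
    ∫ x in a..b, p.eval x = simpsonThreeEighths (fun x => p.eval x) a b := by
  have hn : p.natDegree < 4 := by omega
  rw [integral_eval_eq_sum p hn, simpsonThreeEighths]
  simp only [eval_eq_sum_range' hn, Finset.sum_range_succ, Finset.sum_range_zero]
  push_cast
  ring

/-- (2.5.20) `E = -(3/80) h⁵ f⁽⁴⁾(ξ)`, pinned on quartics (where `f⁽⁴⁾ ≡ 24 c₄` is constant):
`∫_a^b p - R(p) = -(3/80) h⁵ · 24 c₄`, `h = (b - a)/3`. [cite: DavisRabinowitz1984, Sect. 2.5 (2.5.20)] -/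
theorem integral_sub_simpsonThreeEighths_of_natDegree_le_four (p : ℝ[X]) (hp : p.natDegree ≤ 4) (a b : ℝ) :
    (∫ x in a..b, p.eval x) - simpsonThreeEighths (fun x => p.eval x) a b =
      -(3 / 80) * ((b - a) / 3) ^ 5 * (24 * p.coeff 4) := by
  have hn : p.natDegree < 5 := by omega
  rw [integral_eval_eq_sum p hn, simpsonThreeEighths]
  simp only [eval_eq_sum_range' hn, Finset.sum_range_succ, Finset.sum_range_zero]
  push_cast
  ring

/-- In particular the `3/8` rule is *not* exact for `x⁴` on `[0, 1]` (error `-1/270`).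
[cite: DavisRabinowitz1984, Sect. 2.5 (2.5.20)] -/
theorem integral_sub_simpsonThreeEighths_X_pow_four :
    (∫ x in (0 : ℝ)..1, (X ^ 4 : ℝ[X]).eval x) - simpsonThreeEighths (fun x => (X ^ 4 : ℝ[X]).eval x) 0 1 =
      -(1 / 270) := by
  rw [integral_sub_simpsonThreeEighths_of_natDegree_le_four _ (by simp)]
  simp
  norm_num

/-! ### Boole's rule (2.5.21)–(2.5.22) -/

/-- Boole's rule (the closed 5-point Newton–Cotes rule, `h = (b - a)/4`):
`2h/45 (7 f_0 + 32 f_1 + 12 f_2 + 32 f_3 + 7 f_4)`. [cite: DavisRabinowitz1984, Sect. 2.5 (2.5.21)] -/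
def booleRule (f : ℝ → ℝ) (a b : ℝ) : ℝ :=
  (b - a) / 90 *
    (7 * f a + 32 * f (a + (b - a) / 4) + 12 * f (a + (b - a) / 2) + 32 * f (a + 3 * (b - a) / 4) + 7 * f b)

/-- (2.5.21): Boole's rule integrates quintics exactly (one degree more than interpolation on 5 points gives —
the odd-point bonus (2.5.27)). [cite: DavisRabinowitz1984, Sect. 2.5 (2.5.21)] -/
theorem integral_eq_booleRule_of_natDegree_le (p : ℝ[X]) (hp : p.natDegree ≤ 5) (a b : ℝ) :
    ∫ x in a..b, p.eval x = booleRule (fun x => p.eval x) a b := by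
  have hn : p.natDegree < 6 := by omega
  rw [integral_eval_eq_sum p hn, booleRule]
  simp only [eval_eq_sum_range' hn, Finset.sum_range_succ, Finset.sum_range_zero]
  push_cast
  ring

/-- (2.5.22) `E = -(8/945) h⁷ f⁽⁶⁾(ξ)`, pinned on sextics (`f⁽⁶⁾ ≡ 720 c₆`):
`∫_a^b p - R(p) = -(8/945) h⁷ · 720 c₆`, `h = (b - a)/4`. [cite: DavisRabinowitz1984, Sect. 2.5 (2.5.22)] -/
theorem integral_sub_booleRule_of_natDegree_le_six (p : ℝ[X]) (hp : p.natDegree ≤ 6) (a b : ℝ) :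
    (∫ x in a..b, p.eval x) - booleRule (fun x => p.eval x) a b =
      -(8 / 945) * ((b - a) / 4) ^ 7 * (720 * p.coeff 6) := by
  have hn : p.natDegree < 7 := by omega
  rw [integral_eval_eq_sum p hn, booleRule]
  simp only [eval_eq_sum_range' hn, Finset.sum_range_succ, Finset.sum_range_zero]
  push_cast
  ring

/-- In particular Boole's rule is *not* exact for `x⁶` on `[0, 1]` (error `-1/2688`).
[cite: DavisRabinowitz1984, Sect. 2.5 (2.5.22)] -/
theorem integral_sub_booleRule_X_pow_six :
    (∫ x in (0 : ℝ)..1, (X ^ 6 : ℝ[X]).eval x) - booleRule (fun x => (X ^ 6 : ℝ[X]).eval x) 0 1 = -(1 / 2688) := by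
  rw [integral_sub_booleRule_of_natDegree_le_six _ (by simp)]
  simp
  norm_num

/-! ### The odd-point bonus (2.5.27): a symmetric rule exact on `𝒫_n`, `n` even, is exact on `𝒫_{n+1}` -/

/-- **(2.5.27), the mechanism behind it**: a rule `Σ w_i f(x_i)` on `[a, b]` that is symmetric under the
reflection `x ↦ a + b - x` (a permutation `σ` of the nodes with `x_{σ i} = a + b - x_i`, `w_{σ i} = w_i`) and exact
for polynomials of degree `≤ n` with `n` even is automatically exact for degree `≤ n + 1`: the odd function
`(x - (a+b)/2)^{n+1}` is annihilated by both the integral and the rule.  (Hence the closed Newton–Cotes rules with an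
odd number `2k - 1` of points have errors `c_k h^{2k+1} f^{(2k)}(ξ)`, one order more than interpolation predicts.)
[cite: DavisRabinowitz1984, Sect. 2.5 (2.5.27)] -/
theorem exact_natDegree_succ_of_symmetric {ι : Type*} [Fintype ι] {w x : ι → ℝ} {a b : ℝ} (σ : ι ≃ ι)
    (hx : ∀ i, x (σ i) = a + b - x i) (hw : ∀ i, w (σ i) = w i) {n : ℕ} (hn : Even n)
    (hexact : ∀ q : ℝ[X], q.natDegree ≤ n → ∫ t in a..b, q.eval t = ∑ i, w i * q.eval (x i))
    (p : ℝ[X]) (hp : p.natDegree ≤ n + 1) :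
    ∫ t in a..b, p.eval t = ∑ i, w i * p.eval (x i) := by
  set m : ℝ := (a + b) / 2 with hm
  set c : ℝ := p.coeff (n + 1) with hc
  set r : ℝ[X] := (X - C m) ^ (n + 1) with hr
  set q : ℝ[X] := p - C c * r with hq
  -- `q` has degree `≤ n`
  have hrco : ∀ N, r.coeff N = (-m) ^ (n + 1 - N) * ((n + 1).choose N : ℝ) := by
    intro N
    rw [hr, sub_eq_add_neg, ← C_neg, coeff_X_add_C_pow]
  have hqdeg : q.natDegree ≤ n := by
    rw [natDegree_le_iff_coeff_eq_zero]
    intro N hN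
    rw [hq, coeff_sub, coeff_C_mul, hrco]
    rcases Nat.lt_or_ge (n + 1) N with h | h
    · rw [coeff_eq_zero_of_natDegree_lt (by omega), Nat.choose_eq_zero_of_lt h]
      simp
    · have hN' : N = n + 1 := by omega
      subst hN'
      simp [hc]
  have hp_eq : p = q + C c * r := by rw [hq]; ring
  -- the odd part is annihilated by the integral …
  have hint_r : ∫ t in a..b, r.eval t = 0 := by
    have h1 : (fun t => r.eval t) = fun t => (t - m) ^ (n + 1) := by
      funext t
      simp [hr]
    rw [h1, intervalIntegral.integral_comp_sub_right (fun t => t ^ (n + 1)) m, integral_pow]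
    have h2 : a - m = -(b - m) := by rw [hm]; ring
    rw [h2, Even.neg_pow (by rcases hn with ⟨k, hk⟩; exact ⟨k + 1, by omega⟩), sub_self, zero_div]
  -- … and by the symmetric rule
  have hsum_r : ∑ i, w i * r.eval (x i) = 0 := by
    have h1 : ∀ i, r.eval (x i) = (x i - m) ^ (n + 1) := fun i => by simp [hr]
    simp_rw [h1]
    have hodd : Odd (n + 1) := Even.add_one hn
    have h2 : ∑ i, w i * (x i - m) ^ (n + 1) = ∑ i, w (σ i) * (x (σ i) - m) ^ (n + 1) :=
      (Equiv.sum_comp σ (fun i => w i * (x i - m) ^ (n + 1))).symm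
    have h3 : ∀ i, w (σ i) * (x (σ i) - m) ^ (n + 1) = -(w i * (x i - m) ^ (n + 1)) := by
      intro i
      rw [hw, hx, show a + b - x i - m = -(x i - m) by rw [hm]; ring, hodd.neg_pow]
      ring
    rw [Finset.sum_congr rfl fun i _ => h3 i, Finset.sum_neg_distrib] at h2
    linarith
  -- assemble
  have hqx := hexact q hqdeg
  have hqi : IntervalIntegrable (fun t => q.eval t) volume a b := q.continuous.intervalIntegrable _ _
  have hri : IntervalIntegrable (fun t => c * r.eval t) volume a b :=
    (continuous_const.mul r.continuous).intervalIntegrable _ _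
  have hevals : (fun t => p.eval t) = fun t => q.eval t + c * r.eval t := by
    funext t
    rw [hp_eq]
    simp
  have hevx : ∀ i, p.eval (x i) = q.eval (x i) + c * r.eval (x i) := fun i => by
    rw [hp_eq]
    simp
  rw [hevals, intervalIntegral.integral_add hqi hri, intervalIntegral.integral_const_mul, hint_r, mul_zero,
    add_zero, hqx]
  simp_rw [hevx, mul_add, Finset.sum_add_distrib]
  have : ∑ i, w i * (c * r.eval (x i)) = c * ∑ i, w i * r.eval (x i) := by
    rw [Finset.mul_sum]
    refine Finset.sum_congr rfl fun i _ => ?_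
    ring
  rw [this, hsum_r, mul_zero, add_zero]

end

end Literature.Analysis.Quadrature
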